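import Literature.Claims.NS.Baev2022
import Literature.Analysis.PDE.HarmonicSmoothLiouville
import HarnessLib

/-!
# Salvage C113 `Baev2022` — the TRUE typed step: the Neumann–Liouville step (Step 2)

Cell ns-claims (D-0090), salvage seat ns-claims-salvage-p1 (g2). The typed skeleton
`Literature.Claims.NS.Baev2022` (А. В. Баев, Проблемы динамического управления 71 (2022) 4–23) uses on
p.15 (proof of Теорема 3, ¶1; = Следствие 1 (15) p.9 in `ℝⁿ`) the step «Δp = 0, ∇p|_∞ = 0 ⟹ p = const …
положим p = 0», typed as `NeumannLiouville`: a `C²` function `q : ℝ³ → ℝ` with `Δq = 0` everywhere and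
`∇q → 0` at infinity is constant. This step is TRUE and classical (Liouville's theorem applied to the
bounded harmonic map `∇q`; Gilbarg–Trudinger Thm 2.10) — it is the premise `Δp = 0` (Step 1, (12) p.8)
that the cell's refuter lane tests, not this inference. Discharged here from the tree's Literature lemma
`Literature.Analysis.PDE.isConst_of_harmonic_of_tendsto_gradient` (`HarmonicSmoothLiouville`).

WHAT THIS IS NOT: not a claim about NS regularity or blow-up; not a claim about any author beyond the typed
locator.
-/

noncomputable section

open Filter Topology

set_option linter.dupNamespace false

namespace Summit.NavierStokesRegularity.NavierStokesRegularity.Theorems.Baev2022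

open Literature.Claims.NS.Baev2022 Literature.Analysis.PDE

/-- **Step 2 of the skeleton holds** (the Neumann/Liouville step, p.15 ¶1 / Cor. 1 (15) p.9): a `C²`
harmonic function on `ℝ³` whose gradient tends to `0` at infinity is constant.
[cite: Baev2022ru, proof of Теорема 3 ¶1 p.15; Следствие 1 (15) p.9] [cite: GilbargTrudinger2001, Thm 2.10] -/
theorem step2_neumannLiouville_holds : NeumannLiouville := by
  intro q hq hΔ hg
  exact ⟨q 0, fun x => isConst_of_harmonic_of_tendsto_gradient hq hΔ hg x 0⟩

end Summit.NavierStokesRegularity.NavierStokesRegularity.Theorems.Baev2022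

end

-- WHAT THIS IS NOT: not a claim about NS regularity or blow-up; not a claim about any author beyond the typed locator.
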